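import Mathlib.Topology.Covering.Basic
import Mathlib.Topology.Homotopy.Lifting
import Mathlib.Topology.Maps.Proper.Basic

/-!
# Proper local homeomorphisms onto simply connected spaces are homeomorphisms

Crux `WitnessCharge` (stmt-SmoothPoincare4-7824), line `Sketch`, stub `helper_coveringHomeomorph`.

In the completeness step of the pencil argument the intercept map from the connected component of
honest lines is a proper local homeomorphism into `ℂ`; this file supplies the purely point-set
topological fact turning it into a homeomorphism:

* a proper local homeomorphism `f : E → X` from a nonempty connected Hausdorff space to a simply
  connected, locally path-connected space is a homeomorphism.

Proof: the fibres of `f` are compact (properness) and discrete (local injectivity), hence finite;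
a closed local homeomorphism with finite fibres out of a Hausdorff space is a covering map
(`IsClosedMap.isCoveringMapOn_of_isLocalHomeomorphOn`); the identity of the simply connected base
lifts through the covering (`IsCoveringMap.existsUnique_continuousMap_lifts`) to a continuous
section `F` with `f ∘ F = id`, and `F ∘ f = id` by uniqueness of lifts from the connected space
`E` (`IsCoveringMap.eq_of_comp_eq`).
-/

noncomputable section

set_option linter.dupNamespace false

open Set Filter Topology

namespace Summit.SmoothPoincare4.SmoothPoincare4.Theorems.WitnessCharge.PencilIncompleteness

/-- **Proper local homeomorphisms onto simply connected spaces are homeomorphisms.**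
A proper local homeomorphism `f : E → X` from a nonempty connected Hausdorff space `E` to a
simply connected, locally path-connected Hausdorff space `X` is a homeomorphism: it is a finite
covering map, and the identity of the simply connected base lifts to a continuous two-sided
inverse. -/
theorem helper_coveringHomeomorph :
    ∀ (E X : Type) [TopologicalSpace E] [TopologicalSpace X] [T2Space E] [Nonempty E]
      [ConnectedSpace E] [T2Space X] [SimplyConnectedSpace X]
      [LocallyPathConnectedSpace X]
      (f : E → X), IsProperMap f → IsLocalHomeomorph f → IsHomeomorph f := by
  intro E X _ _ _ _ _ _ _ _ f hprop hloc
  -- the fibres of `f` are compact and discrete, hence finite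
  have hfin : ∀ x : X, (f ⁻¹' {x}).Finite := fun x =>
    (hprop.isCompact_preimage isCompact_singleton).finite
      (IsDiscrete.of_openPartialHomeomorph f subset_rfl fun e _ => by
        obtain ⟨φ, hφ, h⟩ := hloc e
        exact ⟨φ, hφ, h.symm⟩)
  -- hence the closed local homeomorphism `f` is a covering map
  have hcov : IsCoveringMap f :=
    isCoveringMap_iff_isCoveringMapOn_univ.mpr
      (hprop.isClosedMap.isCoveringMapOn_of_isLocalHomeomorphOn (fun x _ => hfin x)
        hloc.isLocalHomeomorphOn)
  -- lift the identity of the simply connected base through the covering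
  obtain ⟨e₀⟩ := ‹Nonempty E›
  obtain ⟨F, ⟨hF₀, hF⟩, -⟩ :=
    hcov.existsUnique_continuousMap_lifts (ContinuousMap.id X) (f e₀) e₀ rfl
  have hF' : ∀ x : X, f (F x) = x := fun x => congrFun hF x
  -- both `F ∘ f` and `id` lift `f` through `f` and agree at `e₀`
  have hFf : (F : X → E) ∘ f = id :=
    hcov.eq_of_comp_eq (F.continuous.comp hloc.continuous) continuous_id
      (funext fun e => hF' (f e)) e₀ hF₀
  exact isHomeomorph_iff_exists_inverse.mpr
    ⟨hloc.continuous, F, fun e => congrFun hFf e, hF', F.continuous⟩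

end Summit.SmoothPoincare4.SmoothPoincare4.Theorems.WitnessCharge.PencilIncompleteness

end
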